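import Literature.Analysis.FluidPDE.PressureNormalisationL3
import Literature.Analysis.FluidPDE.NecasRuzickaSverakRiesz
import HarnessLib

/-!
# Pressure normalisation for classical solutions with `L^{2P}` slices (Tao's Lemma 4.1 (i) in `L^r`)

Analysis/FluidPDE proofs file (theorems only) on the discharge path of the corrected form of
`Literature.Analysis.FluidPDE.albritton_singular_point_of_blowup` (Albritton 2018, Cor. 4.6 over
Albritton's class `K̊_p ∩ K̊_∞ ∩ C((0,T); L^p ∩ L^∞)`, `3 < p < ∞`; see
`AlbrittonSingularPointKatoClass.lean`). The printed proof of Prop. 4.5 (arXiv:1612.04439, p. 23)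
works with "`p := (-Δ)⁻¹ div div u ⊗ u`, the pressure associated to `u`", i.e. it presupposes that
the pressure of the (classical, for `t > 0`) mild solution IS the Calderón–Zygmund pressure
`RᵢRⱼ(uᵢuⱼ) ∈ L^{p/2}`; for the tree's classical solutions (`IsClassicalNSSolutionOn`: an
*a priori arbitrary* smooth pressure) this is Tao's pressure-normalisation lemma (T. Tao,
Anal. PDE 6 (2013) = arXiv:1108.1165, Lemma 4.1 (i): "for almost every `t`,
`p = −Δ⁻¹∂ᵢ∂ⱼ(uᵢuⱼ) + C(t)`"), which the tree has for finite energy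
(`NormalisedPressureDischarge.lean`) and for `L³` slices (`PressureNormalisationL3.lean`). This
file is the `L^{2P}` twin, `1 ≤ P < ∞` (so `L^p` slices, `p = 2P ≥ 2`, pressure in `L^{P}`), with
the Riesz pressure entering only through its two defining properties, so that any
`L^P` solution `Q` of the weak Poisson equation `∫ Q Δψ = −∫ D²ψ(u, u)` may be used (for instance
the one of `exists_rieszPressure`, Nečas–Růžička–Šverák 1996 §2):

**Main result** (`pressure_ae_eq_add_const`). Let `(u, p)` be a classical solution of the unforced
Navier–Stokes system (`ν ≥ 0`) on `(t₁, t₂)` with `sup_t ‖u(t)‖_{L^{2P}} ≤ M`, and let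
`Q(t) ∈ L^P`, `‖Q(t)‖_P ≤ N`, solve `∫ Q(t) Δψ = −∫ D²ψ(u(t), u(t))` for all test functions `ψ`,
`t ∈ (t₁, t₂)`. Then for every `t` there is `C(t)` with `p(t, x) = Q(t)(x) + C(t)` for a.e. `x`.
In particular (`pressure_ae_eq_rieszPressure_add_const_Lp`) the pressure of such a solution is,
slice by slice and up to a constant, a Riesz pressure of the velocity, with
`‖p(t) − C(t)‖_{L^P} ≤ C_P ‖u(t)‖²_{L^{2P}}`.

**Proof** — Tao's, exactly as run in `PressureNormalisationL3.lean`, with Hölder on balls in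
place of the `L³` AM–GM bounds: with `g(t) = p(t) − Q(t)` and a normed bump `θ`, `θ ⋆ g(t)` is
harmonic (`harmonicOnNhd_mollified_harmonicPart`) and the probe identity
(`fderiv_mollified_harmonicPart_eq`, ported verbatim with `Q` for `Π[u(t)]`) expresses
`∂ₐ(θ ⋆ g(t))(x₀)` at scale `R ≥ 1` as `νA + B − W' − D`; by Hölder on the ball `B(x₀, 2R+1)`
(`setIntegral_norm_le_of_memLp`: `∫_B |f| ≤ (27|B₁|)^{1-1/q} R^{3-3/q} ‖f‖_q`) each of `A`, `B`,
`D` and the boundary term `W` is `O(R^{-3/(2P)})` uniformly in `t`, and the real-variable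
uniqueness lemma `eq_zero_of_approx_antiderivative` of `HarmonicProbe` gives `∇(θ ⋆ g(t)) = 0`;
mollifications being constant, `g(t)` is a.e. constant
(`ConvolutionLaplacian.ae_eq_const_of_forall_convolution_normed_const`).

## Mathlib / tree search

Tree (reused, not restated): the probe test functions and their bounds
(`PressureNormalisationL3.contDiff_probeConv`, `abs_probeConv_le`, `norm_fderiv_probeConv_le`,
`abs_laplacian_probeConv_le`, `probeConv_comp_sub_eq_zero`, …), `norm_integral_le_of_kernel_bound`,
`hasDerivAt_integral_inner_velocity`, `continuousOn_integral_inner_timeDerivWithin`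
(`PressureNormalisationL3`); `eq_zero_of_approx_antiderivative`, `exists_bound_baseBump_derivs`,
`fderiv_harmonic_eq_integral_probeBump` (`HarmonicProbe`); `ConvolutionLaplacian.*`;
`exists_rieszPressure`, `eLpNorm_norm_sq_eq_mul_two` (`NecasRuzickaSverakRiesz`). Mathlib:
`eLpNorm_le_eLpNorm_mul_rpow_measure_univ`, `Measure.addHaar_real_closedBall'`,
`MemLp.norm_rpow_div`, `is_const_of_fderiv_eq_zero`.
`lean search 'harmonicPart|pressure_ae_eq'`: only the `L³` / finite-energy versions exist.

## References

* T. Tao, *Localisation and compactness properties of the Navier–Stokes global regularity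
  problem*, Anal. PDE 6 (2013) 25–107 = arXiv:1108.1165, §4, Lemma 4.1 (i) and its proof.
  [Tao2011]
* D. Albritton, Anal. PDE 11 (2018) 1415–1456 = arXiv:1612.04439, proof of Prop. 4.5 (p. 23:
  "`p := (-Δ)⁻¹ div div u ⊗ u` is the pressure associated to `u`"). [Albritton2018]
* J. Nečas, M. Růžička, V. Šverák, Acta Math. 176 (1996), §2 p. 285. [NecasRuzickaSverak1996]
-/

noncomputable section

open MeasureTheory Set Filter Metric Function ContinuousLinearMap
open scoped Topology Laplacian ContDiff Convolution InnerProductSpace RealInnerProductSpace ENNReal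
  NNReal

namespace Literature.Analysis.FluidPDE

namespace PressureNormalisationLp

open PressureNormalisationL3

variable {S : Set ℝ} {ν : ℝ} {u : ℝ → (EuclideanSpace ℝ (Fin 3)) → (EuclideanSpace ℝ (Fin 3))}
  {p : ℝ → (EuclideanSpace ℝ (Fin 3)) → ℝ}

/-! ### The harmonic part `g(t) = p(t) − Q` for a weak-Poisson pressure candidate `Q` -/

/-- **The harmonic part is harmonic in the sense of distributions.** For a classical solution of
the unforced system on an open time set `S`, `t ∈ S`, and a locally integrable `Q` solving the weak
Poisson equation `∫ Q Δψ = −∫ D²ψ(u(t), u(t))`, every test function `ψ` has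
`∫ (p(t) − Q) Δψ = 0` (pressure Poisson equation `Δp = −∂ᵢ∂ⱼ(uᵢuⱼ)`, Tao 2011 (8)).
[cite: Tao2011, §4, proof of Lemma 4.1 (i)] -/
theorem integral_harmonicPart_mul_laplacian (h : IsClassicalNSSolutionOn S ν 0 u p)
    (hS : IsOpen S) {t : ℝ} (ht : t ∈ S) {Q : (EuclideanSpace ℝ (Fin 3)) → ℝ}
    (hQloc : LocallyIntegrable Q volume)
    (hQP : ∀ ψ : (EuclideanSpace ℝ (Fin 3)) → ℝ, ContDiff ℝ ∞ ψ → HasCompactSupport ψ →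
      ∫ y, Q y * (Δ ψ) y = -∫ y, fderiv ℝ (fderiv ℝ ψ) y (u t y) (u t y))
    {ψ : (EuclideanSpace ℝ (Fin 3)) → ℝ} (hψ : ContDiff ℝ ∞ ψ) (hψc : HasCompactSupport ψ) :
    ∫ x, (p t x - Q x) * (Δ ψ) x = 0 := by
  have hti : t ∈ interior S := by rwa [hS.interior_eq]
  have hu : ContDiff ℝ ∞ (u t) := h.contDiff_velocity ht
  have hp : ContDiff ℝ ∞ (p t) := h.contDiff_pressure ht
  have hu2 : ContDiff ℝ 2 (u t) := contDiff_infty.1 hu 2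
  have hp2 : ContDiff ℝ 2 (p t) := contDiff_infty.1 hp 2
  have hψ2 : ContDiff ℝ 2 ψ := contDiff_infty.1 hψ 2
  have hΔψc : Continuous (Δ ψ) := FluidPDE.continuous_laplacian hψ2
  have hΔψs : HasCompactSupport (Δ ψ) := hψc.mono' fun x hx => by
    contrapose! hx
    simp [FluidPDE.laplacian_eq_zero_of_notMem_tsupport hx]
  -- the pressure Poisson equation `Δ p = -G[u]`
  have hPoisson : ∀ x, (Δ (p t)) x = -pressureSource (u t) x := fun x => by
    rw [laplacian_pressure_eq_of_isClassicalNSSolutionOn h hti x,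
      pressureSource_eq_of_isDivFree (h.divFree t ht)]
    have : VectorCalculus.divergence
        ((0 : ℝ → (EuclideanSpace ℝ (Fin 3)) → (EuclideanSpace ℝ (Fin 3))) t) x = 0 := by
      simp [VectorCalculus.divergence]
    rw [this, add_zero]
  -- `∫ p Δψ = ∫ ψ Δp = -∫ ψ G[u] = -∫ D²ψ(u, u)`
  have h1 : ∫ x, p t x * (Δ ψ) x = -∫ x, fderiv ℝ (fderiv ℝ ψ) x (u t x) (u t x) := by
    have e1 : ∫ x, p t x * (Δ ψ) x = ∫ x, (Δ ψ) x * p t x :=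
      integral_congr_ae (Eventually.of_forall fun x => mul_comm _ _)
    rw [e1, ← integral_mul_laplacian_comm hp2 hψ2 hψc, ← integral_mul_pressureSource hψ2 hψc hu2,
      ← integral_neg]
    refine integral_congr_ae (Eventually.of_forall fun x => ?_)
    show ψ x * (Δ (p t)) x = -(ψ x * pressureSource (u t) x)
    rw [hPoisson x]
    ring
  -- integrability, to split the difference
  have i1 : Integrable fun x => p t x * (Δ ψ) x :=
    (hp.continuous.mul hΔψc).integrable_of_hasCompactSupport hΔψs.mul_left
  have i2 : Integrable fun x => Q x * (Δ ψ) x := by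
    have hK : IsCompact (tsupport (Δ ψ)) := hΔψs
    have hon : IntegrableOn (fun x => Q x * (Δ ψ) x) (tsupport (Δ ψ)) :=
      (hQloc.integrableOn_isCompact hK).mul_continuousOn hΔψc.continuousOn hK
    exact (integrableOn_iff_integrable_of_support_subset
      ((support_mul_subset_right _ _).trans (subset_tsupport _))).1 hon
  have e : ∫ x, (p t x - Q x) * (Δ ψ) x = ∫ x, (p t x * (Δ ψ) x - Q x * (Δ ψ) x) :=
    integral_congr_ae (Eventually.of_forall fun x => sub_mul _ _ _)
  rw [e, integral_sub i1 i2, h1, hQP ψ hψ hψc, sub_self]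

/-- The harmonic part `p(t) − Q` is locally integrable (continuous minus locally integrable).
[folklore] -/
theorem locallyIntegrable_harmonicPart (h : IsClassicalNSSolutionOn S ν 0 u p) {t : ℝ}
    (ht : t ∈ S) {Q : (EuclideanSpace ℝ (Fin 3)) → ℝ} (hQloc : LocallyIntegrable Q volume) :
    LocallyIntegrable (fun x => p t x - Q x) volume :=
  (h.contDiff_pressure ht).continuous.locallyIntegrable.sub hQloc

/-- **Every mollification of the harmonic part is harmonic on `ℝ³`** (`θ` smooth with compact
support). [cite: Tao2011, §4, proof of Lemma 4.1 (i)] -/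
theorem harmonicOnNhd_mollified_harmonicPart (h : IsClassicalNSSolutionOn S ν 0 u p)
    (hS : IsOpen S) {t : ℝ} (ht : t ∈ S) {Q : (EuclideanSpace ℝ (Fin 3)) → ℝ}
    (hQloc : LocallyIntegrable Q volume)
    (hQP : ∀ ψ : (EuclideanSpace ℝ (Fin 3)) → ℝ, ContDiff ℝ ∞ ψ → HasCompactSupport ψ →
      ∫ y, Q y * (Δ ψ) y = -∫ y, fderiv ℝ (fderiv ℝ ψ) y (u t y) (u t y))
    {θ : (EuclideanSpace ℝ (Fin 3)) → ℝ} (hθ : ContDiff ℝ ∞ θ) (hθc : HasCompactSupport θ) :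
    InnerProductSpace.HarmonicOnNhd (θ ⋆ fun x => p t x - Q x) univ :=
  ConvolutionLaplacian.harmonicOnNhd_convolution (locallyIntegrable_harmonicPart h ht hQloc)
    (fun _ hψ hψc => integral_harmonicPart_mul_laplacian h hS ht hQloc hQP hψ hψc) hθ hθc

/-! ### The probe identity for the mollified harmonic part -/

/-- **The probe identity** (Tao 2011, §4, proof of Lemma 4.1 (i), the computation of
`∫∫ ∇h χ_R`), for the harmonic part `p(t) − Q` with any locally integrable weak-Poisson pressure
candidate `Q` (cf. `PressureNormalisationL3.fderiv_mollified_harmonicPart_eq`, the case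
`Q = Π[u(t)]`, `u(t) ∈ L³`, whose proof this is, verbatim): with `θ = φ.normed`, `R > 0`,
`Φ = χ_R ⋆ θ`, for every centre `x₀` and direction `a`,
`∂ₐ(θ ⋆ (p(t) − Q))(x₀) = ν ∫⟪u, ΔΨ⟫ + ∫⟪u, (u·∇)Ψ⟫ − ∫⟪∂ₜu, Ψ⟫ − ∫ ∂ₐΦ(y) Q(x₀ − y) dy`,
`Ψ(y) = Φ(x₀ − y) a`. [cite: Tao2011, §4, proof of Lemma 4.1 (i)] -/
theorem fderiv_mollified_harmonicPart_eq (h : IsClassicalNSSolutionOn S ν 0 u p) (hS : IsOpen S)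
    {t : ℝ} (ht : t ∈ S) {Q : (EuclideanSpace ℝ (Fin 3)) → ℝ} (hQloc : LocallyIntegrable Q volume)
    (hQP : ∀ ψ : (EuclideanSpace ℝ (Fin 3)) → ℝ, ContDiff ℝ ∞ ψ → HasCompactSupport ψ →
      ∫ y, Q y * (Δ ψ) y = -∫ y, fderiv ℝ (fderiv ℝ ψ) y (u t y) (u t y))
    (φ : ContDiffBump (0 : (EuclideanSpace ℝ (Fin 3)))) {R : ℝ}
    (hR : 0 < R) (x₀ a : (EuclideanSpace ℝ (Fin 3))) :
    fderiv ℝ (φ.normed volume ⋆ fun x => p t x - Q x) x₀ a =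
      ν * (∫ y, ⟪u t y, (Δ (fun y => (probeBump R ⋆ φ.normed volume) (x₀ - y))) y • a⟫)
      + (∫ y, ⟪u t y,
          fderiv ℝ (fun y => (probeBump R ⋆ φ.normed volume) (x₀ - y)) y (u t y) • a⟫)
      - (∫ y, ⟪FluidPDE.timeDerivWithin S u t y, (probeBump R ⋆ φ.normed volume) (x₀ - y) • a⟫)
      - ∫ y, fderiv ℝ (probeBump R ⋆ φ.normed volume) y a * Q (x₀ - y) := by
  haveI : CompleteSpace (EuclideanSpace ℝ (Fin 3)) := inferInstance
  -- names
  set g : (EuclideanSpace ℝ (Fin 3)) → ℝ := fun x => p t x - Q x with hg_def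
  set θ : (EuclideanSpace ℝ (Fin 3)) → ℝ := φ.normed volume with hθ_def
  set χ : (EuclideanSpace ℝ (Fin 3)) → ℝ := probeBump R with hχ_def
  set Φ : (EuclideanSpace ℝ (Fin 3)) → ℝ := χ ⋆ θ with hΦ_def
  -- regularity of the data
  have hu : ContDiff ℝ ∞ (u t) := h.contDiff_velocity ht
  have hp : ContDiff ℝ ∞ (p t) := h.contDiff_pressure ht
  have hu2 : ContDiff ℝ 2 (u t) := contDiff_infty.1 hu 2
  have hu1 : ContDiff ℝ 1 (u t) := contDiff_infty.1 hu 1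
  have hp1 : ContDiff ℝ 1 (p t) := contDiff_infty.1 hp 1
  have huc : Continuous (u t) := hu.continuous
  have hgloc : LocallyIntegrable g volume := locallyIntegrable_harmonicPart h ht hQloc
  have hθs : ContDiff ℝ ∞ θ := φ.contDiff_normed
  have hθc : HasCompactSupport θ := φ.hasCompactSupport_normed
  have hχs : ContDiff ℝ ∞ χ := contDiff_probeBump R
  have hχc : HasCompactSupport χ := hasCompactSupport_probeBump hR
  have hχ1 : ContDiff ℝ 1 χ := contDiff_infty.1 hχs 1
  have hΦs : ContDiff ℝ ∞ Φ := contDiff_probeConv φ hR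
  have hΦc : HasCompactSupport Φ := hasCompactSupport_probeConv φ hR
  have hΦ1 : ContDiff ℝ 1 Φ := contDiff_infty.1 hΦs 1
  have hΦ2 : ContDiff ℝ 2 Φ := contDiff_infty.1 hΦs 2
  -- Step 1: mean-value formula for the gradient of the harmonic function `θ ⋆ g`
  have hη := harmonicOnNhd_mollified_harmonicPart h hS ht hQloc hQP hθs hθc
  rw [fderiv_harmonic_eq_integral_probeBump hη hR x₀ a]
  -- Step 2: `∫ ∂ₐχ_R(z) (θ ⋆ g)(x₀ - z) dz = ((∂ₐχ_R ⋆ θ) ⋆ g)(x₀) = ∫ ∂ₐΦ(y) g(x₀ - y) dy`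
  have hχa : Continuous fun z => fderiv ℝ χ z a :=
    (hχ1.continuous_fderiv one_ne_zero).clm_apply continuous_const
  have hχac : HasCompactSupport fun z => fderiv ℝ χ z a := hχc.fderiv_apply (𝕜 := ℝ) a
  have e1 : ∫ z, fderiv ℝ χ z a * (θ ⋆ g) (x₀ - z) = ((fun z => fderiv ℝ χ z a) ⋆ (θ ⋆ g)) x₀ := by
    rw [convolution_lsmul]
    rfl
  have e2 : ((fun z => fderiv ℝ χ z a) ⋆ (θ ⋆ g)) x₀ = (((fun z => fderiv ℝ χ z a) ⋆ θ) ⋆ g) x₀ :=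
    (ConvolutionLaplacian.convolution_assoc_of_hasCompactSupport hχa hχac φ.continuous_normed hθc
      hgloc x₀).symm
  have e3 : (fun z => fderiv ℝ χ z a) ⋆ θ = fun y => fderiv ℝ Φ y a :=
    funext fun y => (fderiv_probeConv_apply φ hR y a).symm
  rw [e1, e2, e3, convolution_lsmul]
  simp only [smul_eq_mul]
  -- Step 3: split `g = p - Q`
  have hΦa : Continuous fun y => fderiv ℝ Φ y a :=
    (hΦ1.continuous_fderiv one_ne_zero).clm_apply continuous_const
  have hΦac : HasCompactSupport fun y => fderiv ℝ Φ y a := hΦc.fderiv_apply (𝕜 := ℝ) a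
  have iP : Integrable fun y => fderiv ℝ Φ y a * p t (x₀ - y) :=
    (hΦa.mul (hp.continuous.comp (continuous_const.sub continuous_id))).integrable_of_hasCompactSupport
      hΦac.mul_right
  have iQ : Integrable fun y => fderiv ℝ Φ y a * Q (x₀ - y) :=
    (hΦac.convolutionExists_left (lsmul ℝ ℝ : ℝ →L[ℝ] ℝ →L[ℝ] ℝ) hΦa hQloc x₀).integrable
  have e4 : ∫ y, fderiv ℝ Φ y a * g (x₀ - y) =
      (∫ y, fderiv ℝ Φ y a * p t (x₀ - y)) - ∫ y, fderiv ℝ Φ y a * Q (x₀ - y) := by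
    rw [← integral_sub iP iQ]
    refine integral_congr_ae (Eventually.of_forall fun y => ?_)
    simp only [hg_def, mul_sub]
  rw [e4]
  -- Step 4: the pressure part through the momentum equation
  -- the test field `Ψ(y) = Φ(x₀ - y) a`
  set ψ : (EuclideanSpace ℝ (Fin 3)) → ℝ := fun y => Φ (x₀ - y) with hψ_def
  have hψs : ContDiff ℝ ∞ ψ := hΦs.comp (contDiff_const.sub contDiff_id)
  have hψ2 : ContDiff ℝ 2 ψ := contDiff_infty.1 hψs 2
  have hψ1 : ContDiff ℝ 1 ψ := contDiff_infty.1 hψs 1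
  have hψc : HasCompactSupport ψ := hΦc.comp_homeomorph (Homeomorph.subLeft x₀)
  set Ψ : (EuclideanSpace ℝ (Fin 3)) → (EuclideanSpace ℝ (Fin 3)) := fun y => ψ y • a with hΨ_def
  have hΨ2 : ContDiff ℝ 2 Ψ := hψ2.smul contDiff_const
  have hΨ1 : ContDiff ℝ 1 Ψ := hψ1.smul contDiff_const
  have hΨc : HasCompactSupport Ψ := hψc.smul_right (f' := fun _ => a)
  have hΨcont : Continuous Ψ := hΨ1.continuous
  have hDΨ : ∀ y w, fderiv ℝ Ψ y w = (fderiv ℝ ψ y w) • a := fun y w => by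
    simp only [hΨ_def]
    rw [fderiv_smul_const (hψ1.differentiable one_ne_zero y), ContinuousLinearMap.smulRight_apply]
  have hΔΨ : ∀ y, (Δ Ψ) y = (Δ ψ) y • a := fun y => by
    have e : Ψ = (ContinuousLinearMap.toSpanSingleton ℝ a) ∘ ψ := by
      funext w; simp [hΨ_def, ContinuousLinearMap.toSpanSingleton_apply]
    rw [e, hψ2.contDiffAt.laplacian_CLM_comp_left]
    simp [ContinuousLinearMap.toSpanSingleton_apply]
  -- continuity of the slices entering the momentum equation
  have hΔuc : Continuous (Δ (u t)) := FluidPDE.continuous_laplacian hu2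
  have hdtc : Continuous (FluidPDE.timeDerivWithin S u t) :=
    ((h.smooth_velocity.timeDerivWithin hS.uniqueDiffOn).contDiff_slice ht).continuous
  have hcvc : Continuous (FluidPDE.convect (u t) (u t)) :=
    (hu1.continuous_fderiv one_ne_zero).clm_apply huc
  -- integration by parts, then change of variables `y ↦ x₀ - y`
  have e5 : ∫ y, fderiv ℝ Φ y a * p t (x₀ - y) = ∫ y, ⟪gradient (p t) y, Ψ y⟫ := by
    rw [integral_fderiv_mul_comp_sub hΦ1 hΦc hp1 x₀ a,
      ← integral_sub_left_eq_self (fun y => Φ y * fderiv ℝ (p t) (x₀ - y) a) volume x₀]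
    refine integral_congr_ae (Eventually.of_forall fun y => ?_)
    have hgr : ⟪gradient (p t) y, a⟫ = fderiv ℝ (p t) y a := by
      rw [real_inner_comm, inner_gradient_eq_fderiv_apply]
    simp only [sub_sub_cancel, hΨ_def, hψ_def, inner_smul_right, hgr]
  have iL := FluidPDE.integrable_inner_of_hasCompactSupport_right hΔuc hΨcont hΨc
  have iT := FluidPDE.integrable_inner_of_hasCompactSupport_right hdtc hΨcont hΨc
  have iC := FluidPDE.integrable_inner_of_hasCompactSupport_right hcvc hΨcont hΨc
  have e6 : ∫ y, ⟪gradient (p t) y, Ψ y⟫ =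
      ν * (∫ y, ⟪(Δ (u t)) y, Ψ y⟫) - (∫ y, ⟪FluidPDE.timeDerivWithin S u t y, Ψ y⟫) -
        ∫ y, ⟪FluidPDE.convect (u t) (u t) y, Ψ y⟫ := by
    have key : ∀ y, ⟪gradient (p t) y, Ψ y⟫ = ν * ⟪(Δ (u t)) y, Ψ y⟫ -
        ⟪FluidPDE.timeDerivWithin S u t y, Ψ y⟫ - ⟪FluidPDE.convect (u t) (u t) y, Ψ y⟫ := by
      intro y
      rw [PressureNormalisationL3.gradient_pressure_eq h ht y, inner_sub_left, inner_sub_left, inner_smul_left]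
      simp
    have i2 : Integrable fun y => ν * ⟪(Δ (u t)) y, Ψ y⟫ := iL.const_mul ν
    have i1 : Integrable fun y => ν * ⟪(Δ (u t)) y, Ψ y⟫ -
        ⟪FluidPDE.timeDerivWithin S u t y, Ψ y⟫ := i2.sub iT
    rw [integral_congr_ae (Eventually.of_forall key), integral_sub i1 iC, integral_sub i2 iT,
      integral_const_mul]
  -- Green's identity for the viscous term
  have e7 : ∫ y, ⟪(Δ (u t)) y, Ψ y⟫ = ∫ y, ⟪u t y, (Δ ψ) y • a⟫ := by
    rw [FluidPDE.integral_inner_laplacian_comm hu2 hΨ2 hΨc]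
    exact integral_congr_ae (Eventually.of_forall fun y => by
      show ⟪u t y, (Δ Ψ) y⟫ = ⟪u t y, (Δ ψ) y • a⟫
      rw [hΔΨ y])
  -- the trilinear identity for the transport term
  have e8 : ∫ y, ⟪FluidPDE.convect (u t) (u t) y, Ψ y⟫ =
      -∫ y, ⟪u t y, fderiv ℝ ψ y (u t y) • a⟫ := by
    have h0 := FluidPDE.integral_inner_convect_add_eq_zero hu1 hu1 hΨ1 hΨc
    have hz : ∫ y, VectorCalculus.divergence (u t) y * ⟪u t y, Ψ y⟫ = 0 := by
      simp [h.divFree t ht _]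
    have hc : ∫ y, ⟪u t y, FluidPDE.convect (u t) Ψ y⟫ = ∫ y, ⟪u t y, fderiv ℝ ψ y (u t y) • a⟫ :=
      integral_congr_ae (Eventually.of_forall fun y => by simp only [FluidPDE.convect, hDΨ])
    linarith
  rw [e5, e6, e7, e8]
  ring


/-! ### Hölder on balls -/

/-- The volume of the ball `B̄(x₀, ρ)` in `ℝ³`: `ρ³ vol B̄(0,1)`. [folklore] -/
theorem volume_real_closedBall (x₀ : (EuclideanSpace ℝ (Fin 3))) {ρ : ℝ} (hρ : 0 ≤ ρ) :
    (volume : Measure (EuclideanSpace ℝ (Fin 3))).real (closedBall x₀ ρ) =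
      ρ ^ 3 * (volume : Measure (EuclideanSpace ℝ (Fin 3))).real
        (closedBall (0 : (EuclideanSpace ℝ (Fin 3))) 1) := by
  rw [Measure.addHaar_real_closedBall' volume x₀ hρ, finrank_euclideanSpace_fin]

/-- The ball `B̄(x₀, 2R+1)` has volume `≤ 27R³ vol B̄(0,1)` for `R ≥ 1`. [folklore] -/
theorem volume_real_closedBall_le {R : ℝ} (hR : 1 ≤ R) (x₀ : (EuclideanSpace ℝ (Fin 3))) :
    (volume : Measure (EuclideanSpace ℝ (Fin 3))).real (closedBall x₀ (2 * R + 1)) ≤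
      27 * (volume : Measure (EuclideanSpace ℝ (Fin 3))).real
        (closedBall (0 : (EuclideanSpace ℝ (Fin 3))) 1) * R ^ 3 := by
  rw [volume_real_closedBall x₀ (by linarith)]
  have h : (2 * R + 1) ^ 3 ≤ 27 * R ^ 3 := by
    nlinarith [pow_le_pow_left₀ (by linarith : (0:ℝ) ≤ 2 * R + 1) (by linarith : 2 * R + 1 ≤ 3 * R) 3]
  calc (2 * R + 1) ^ 3 * (volume : Measure (EuclideanSpace ℝ (Fin 3))).real
        (closedBall (0 : (EuclideanSpace ℝ (Fin 3))) 1)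
      ≤ 27 * R ^ 3 * (volume : Measure (EuclideanSpace ℝ (Fin 3))).real
        (closedBall (0 : (EuclideanSpace ℝ (Fin 3))) 1) :=
        mul_le_mul_of_nonneg_right h measureReal_nonneg
    _ = _ := by ring

/-- **Hölder on a ball**: for `1 ≤ q < ∞` and `f ∈ L^q`,
`∫_{B̄(x₀,ρ)} ‖f‖ ≤ |B̄(x₀,ρ)|^{1 − 1/q} ‖f‖_{L^q}`. [folklore] -/
theorem setIntegral_norm_le_of_memLp {F' : Type*} [NormedAddCommGroup F']
    {f : (EuclideanSpace ℝ (Fin 3)) → F'} {q : ℝ≥0∞} (hq1 : 1 ≤ q) (hq : q ≠ ⊤)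
    (hf : MemLp f q volume) (x₀ : (EuclideanSpace ℝ (Fin 3))) (ρ : ℝ) :
    ∫ y in closedBall x₀ ρ, ‖f y‖ ≤
      ((volume : Measure (EuclideanSpace ℝ (Fin 3))).real (closedBall x₀ ρ)) ^ (1 - 1 / q.toReal) *
        (eLpNorm f q volume).toReal := by
  set B := closedBall x₀ ρ with hB
  have hBfin : volume B < ⊤ := measure_closedBall_lt_top
  have hm : AEStronglyMeasurable f (volume.restrict B) := hf.1.restrict
  have h1 : eLpNorm f 1 (volume.restrict B) ≤
      eLpNorm f q (volume.restrict B) * (volume.restrict B) univ ^ (1 - 1 / q.toReal) := by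
    have h := eLpNorm_le_eLpNorm_mul_rpow_measure_univ (p := 1) (q := q) hq1 hm
    have he : 1 / (1 : ℝ≥0∞).toReal - 1 / q.toReal = 1 - 1 / q.toReal := by
      rw [ENNReal.toReal_one, div_one]
    rwa [he] at h
  rw [Measure.restrict_apply_univ] at h1
  have h2 : eLpNorm f 1 (volume.restrict B) ≤ eLpNorm f q volume * volume B ^ (1 - 1 / q.toReal) :=
    h1.trans (mul_le_mul' (eLpNorm_restrict_le _ _ _ _) le_rfl)
  have hexp : 0 ≤ 1 - 1 / q.toReal := by
    rw [sub_nonneg, div_le_one (ENNReal.toReal_pos (zero_lt_one.trans_le hq1).ne' hq)]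
    have := (ENNReal.toReal_le_toReal ENNReal.one_ne_top hq).2 hq1
    rwa [ENNReal.toReal_one] at this
  have hne : eLpNorm f q volume * volume B ^ (1 - 1 / q.toReal) ≠ ⊤ :=
    ENNReal.mul_ne_top hf.eLpNorm_ne_top (ENNReal.rpow_ne_top_of_nonneg hexp hBfin.ne)
  have h3 := ENNReal.toReal_mono hne h2
  rw [eLpNorm_one_eq_lintegral_enorm, ENNReal.toReal_mul, ← ENNReal.toReal_rpow] at h3
  have e : ∫ y in B, ‖f y‖ = (∫⁻ y in B, ‖f y‖ₑ).toReal := integral_norm_eq_lintegral_enorm hm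
  rw [e, measureReal_def, mul_comm]
  exact h3

/-- Exponent algebra: `(R³)⁻¹ R⁻ᵏ R^{3−s} = R^{−(k+s)}` for `R > 0`. [folklore] -/
theorem rpow_kernel_algebra {R : ℝ} (hR : 0 < R) (k : ℕ) (s : ℝ) :
    (R ^ 3)⁻¹ * R⁻¹ ^ k * R ^ (3 - s) = R ^ (-((k : ℝ) + s)) := by
  have h3 : (R ^ 3)⁻¹ = R ^ (-(3 : ℝ)) := by
    rw [Real.rpow_neg hR.le]
    norm_cast
  have hk : R⁻¹ ^ k = R ^ (-(k : ℝ)) := by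
    rw [Real.rpow_neg hR.le, Real.rpow_natCast, inv_pow]
  rw [h3, hk, ← Real.rpow_add hR, ← Real.rpow_add hR]
  congr 1
  ring

/-- **Hölder on the probe ball**: for `1 ≤ q < ∞`, `f ∈ L^q` and `R ≥ 1`,
`∫_{B̄(x₀,2R+1)} ‖f‖ ≤ (27|B₁|)^{1−1/q} R^{3−3/q} ‖f‖_{L^q}`. [folklore] -/
theorem setIntegral_norm_probeBall_le {F' : Type*} [NormedAddCommGroup F']
    {f : (EuclideanSpace ℝ (Fin 3)) → F'} {q : ℝ≥0∞} (hq1 : 1 ≤ q) (hq : q ≠ ⊤)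
    (hf : MemLp f q volume) {R : ℝ} (hR1 : 1 ≤ R) (x₀ : (EuclideanSpace ℝ (Fin 3))) :
    ∫ y in closedBall x₀ (2 * R + 1), ‖f y‖ ≤
      (27 * (volume : Measure (EuclideanSpace ℝ (Fin 3))).real
          (closedBall (0 : (EuclideanSpace ℝ (Fin 3))) 1)) ^ (1 - 1 / q.toReal) *
        R ^ (3 - 3 / q.toReal) * (eLpNorm f q volume).toReal := by
  have hR : 0 < R := one_pos.trans_le hR1
  set V₁ := (volume : Measure (EuclideanSpace ℝ (Fin 3))).real
    (closedBall (0 : (EuclideanSpace ℝ (Fin 3))) 1) with hV₁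
  have hV₁0 : 0 ≤ V₁ := measureReal_nonneg
  set θ : ℝ := 1 - 1 / q.toReal with hθ
  have hθ0 : 0 ≤ θ := by
    rw [hθ, sub_nonneg, div_le_one (ENNReal.toReal_pos (zero_lt_one.trans_le hq1).ne' hq)]
    have := (ENNReal.toReal_le_toReal ENNReal.one_ne_top hq).2 hq1
    rwa [ENNReal.toReal_one] at this
  have h1 := setIntegral_norm_le_of_memLp hq1 hq hf x₀ (2 * R + 1)
  have hvol := volume_real_closedBall_le hR1 x₀
  have h2 : ((volume : Measure (EuclideanSpace ℝ (Fin 3))).real (closedBall x₀ (2 * R + 1))) ^ θ ≤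
      (27 * V₁) ^ θ * R ^ (3 - 3 / q.toReal) := by
    calc ((volume : Measure (EuclideanSpace ℝ (Fin 3))).real (closedBall x₀ (2 * R + 1))) ^ θ
        ≤ (27 * V₁ * R ^ 3) ^ θ := Real.rpow_le_rpow measureReal_nonneg hvol hθ0
      _ = (27 * V₁) ^ θ * (R ^ 3) ^ θ := Real.mul_rpow (by positivity) (by positivity)
      _ = (27 * V₁) ^ θ * R ^ (3 - 3 / q.toReal) := by
          congr 1
          rw [← Real.rpow_natCast R 3, ← Real.rpow_mul hR.le]
          congr 1
          rw [hθ]; push_cast; ring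
  calc ∫ y in closedBall x₀ (2 * R + 1), ‖f y‖
      ≤ ((volume : Measure (EuclideanSpace ℝ (Fin 3))).real (closedBall x₀ (2 * R + 1))) ^ θ *
          (eLpNorm f q volume).toReal := h1
    _ ≤ (27 * V₁) ^ θ * R ^ (3 - 3 / q.toReal) * (eLpNorm f q volume).toReal :=
        mul_le_mul_of_nonneg_right h2 ENNReal.toReal_nonneg


/-! ### The four probe terms are `O(R^{-3/(2P)})` -/

section Bounds

variable (φ : ContDiffBump (0 : (EuclideanSpace ℝ (Fin 3))))

/-- **The boundary term** `W = ∫ ⟪v, Φ(x₀ − ·) a⟫`: for `v` continuous with `‖v‖_{L^q} ≤ M`,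
`1 ≤ q < ∞`, and `R ≥ 1`, `|W| ≤ K M R^{−3/q}` (`|Φ| ≤ (mR³)⁻¹` on a ball of volume
`≤ 27R³|B₁|`, Hölder). [folklore] -/
theorem exists_bound_boundary {q : ℝ≥0∞} (hq1 : 1 ≤ q) (hq : q ≠ ⊤) (hφ : φ.rOut ≤ 1)
    (a : (EuclideanSpace ℝ (Fin 3))) : ∃ K, 0 ≤ K ∧
    ∀ (v : (EuclideanSpace ℝ (Fin 3)) → (EuclideanSpace ℝ (Fin 3))) (M : ℝ), Continuous v →
      MemLp v q volume → (eLpNorm v q volume).toReal ≤ M → ∀ R : ℝ, 1 ≤ R →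
      ∀ x₀ : (EuclideanSpace ℝ (Fin 3)),
      (Integrable fun y => ⟪v y, (probeBump R ⋆ φ.normed volume) (x₀ - y) • a⟫) ∧
      |∫ y, ⟪v y, (probeBump R ⋆ φ.normed volume) (x₀ - y) • a⟫| ≤
        K * M * R ^ (-((0 : ℕ) + 3 / q.toReal)) := by
  set m := baseBumpMass (EuclideanSpace ℝ (Fin 3)) with hm_def
  have hm : 0 < m := baseBumpMass_pos
  set V₁ := (volume : Measure (EuclideanSpace ℝ (Fin 3))).real
    (closedBall (0 : (EuclideanSpace ℝ (Fin 3))) 1) with hV₁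
  have hV₁0 : 0 ≤ V₁ := measureReal_nonneg
  refine ⟨‖a‖ * m⁻¹ * (27 * V₁) ^ (1 - 1 / q.toReal), by positivity, ?_⟩
  intro v M hvc hvq hvM R hR1 x₀
  have hR : 0 < R := one_pos.trans_le hR1
  have hM0 : 0 ≤ M := ENNReal.toReal_nonneg.trans hvM
  set Φ := probeBump R ⋆ φ.normed volume with hΦ
  have hΦc : Continuous Φ := (contDiff_probeConv φ hR (n := 0)).continuous
  -- kernel bound and support
  have hκ : 0 ≤ ‖a‖ * (m * R ^ 3)⁻¹ := by positivity
  have hF : ∀ y, ‖⟪v y, Φ (x₀ - y) • a⟫‖ ≤ ‖a‖ * (m * R ^ 3)⁻¹ * ‖v y‖ := fun y => by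
    rw [Real.norm_eq_abs, inner_smul_right, abs_mul]
    calc |Φ (x₀ - y)| * |⟪v y, a⟫| ≤ (m * R ^ 3)⁻¹ * (‖v y‖ * ‖a‖) :=
          mul_le_mul (abs_probeConv_le φ hR _) (abs_real_inner_le_norm _ _) (abs_nonneg _)
            (by positivity)
      _ = ‖a‖ * (m * R ^ 3)⁻¹ * ‖v y‖ := by ring
  have hF0 : ∀ y, 2 * R + 1 < dist y x₀ → ⟪v y, Φ (x₀ - y) • a⟫ = 0 := fun y hy => by
    rw [hΦ, probeConv_comp_sub_eq_zero φ hφ hR x₀ hy, zero_smul, inner_zero_right]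
  have hFm : AEStronglyMeasurable (fun y => ⟪v y, Φ (x₀ - y) • a⟫) volume :=
    (hvc.inner ((hΦc.comp (continuous_const.sub continuous_id)).smul
      continuous_const)).aestronglyMeasurable
  obtain ⟨hint, hI⟩ := norm_integral_le_of_kernel_bound
    (hvc.norm.continuousOn.integrableOn_compact (isCompact_closedBall x₀ (2 * R + 1))) hFm hF hF0
  refine ⟨hint, ?_⟩
  rw [← Real.norm_eq_abs]
  refine hI.trans ?_
  have hB := setIntegral_norm_probeBall_le hq1 hq hvq hR1 x₀
  calc ‖a‖ * (m * R ^ 3)⁻¹ * ∫ y in closedBall x₀ (2 * R + 1), ‖v y‖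
      ≤ ‖a‖ * (m * R ^ 3)⁻¹ * ((27 * V₁) ^ (1 - 1 / q.toReal) * R ^ (3 - 3 / q.toReal) * M) := by
        refine mul_le_mul_of_nonneg_left (hB.trans ?_) hκ
        exact mul_le_mul_of_nonneg_left hvM (by positivity)
    _ = ‖a‖ * m⁻¹ * (27 * V₁) ^ (1 - 1 / q.toReal) * M *
          ((R ^ 3)⁻¹ * R⁻¹ ^ (0 : ℕ) * R ^ (3 - 3 / q.toReal)) := by
        rw [mul_inv, pow_zero]; ring
    _ = ‖a‖ * m⁻¹ * (27 * V₁) ^ (1 - 1 / q.toReal) * M * R ^ (-((0 : ℕ) + 3 / q.toReal)) := by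
        rw [rpow_kernel_algebra hR]

/-- **The viscous term** `A = ∫ ⟪v, Δ(Φ(x₀ − ·)) a⟫`: `|A| ≤ K M R^{−(2 + 3/q)}`
(`|ΔΦ| ≤ C₂(mR³)⁻¹R⁻²`, Hölder). [folklore] -/
theorem exists_bound_laplacian {q : ℝ≥0∞} (hq1 : 1 ≤ q) (hq : q ≠ ⊤) (hφ : φ.rOut ≤ 1)
    (a : (EuclideanSpace ℝ (Fin 3))) : ∃ K, 0 ≤ K ∧
    ∀ (v : (EuclideanSpace ℝ (Fin 3)) → (EuclideanSpace ℝ (Fin 3))) (M : ℝ), Continuous v →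
      MemLp v q volume → (eLpNorm v q volume).toReal ≤ M → ∀ R : ℝ, 1 ≤ R →
      ∀ x₀ : (EuclideanSpace ℝ (Fin 3)),
      |∫ y, ⟪v y, (Δ (fun y => (probeBump R ⋆ φ.normed volume) (x₀ - y))) y • a⟫| ≤
        K * M * R ^ (-((2 : ℕ) + 3 / q.toReal)) := by
  obtain ⟨⟨C₁, hC₁⟩, ⟨C₂, hC₂⟩⟩ := exists_bound_baseBump_derivs (E := (EuclideanSpace ℝ (Fin 3)))
  have hC₂0 : 0 ≤ C₂ := (abs_nonneg _).trans (hC₂ 0)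
  set m := baseBumpMass (EuclideanSpace ℝ (Fin 3)) with hm_def
  have hm : 0 < m := baseBumpMass_pos
  set V₁ := (volume : Measure (EuclideanSpace ℝ (Fin 3))).real
    (closedBall (0 : (EuclideanSpace ℝ (Fin 3))) 1) with hV₁
  have hV₁0 : 0 ≤ V₁ := measureReal_nonneg
  refine ⟨‖a‖ * m⁻¹ * C₂ * (27 * V₁) ^ (1 - 1 / q.toReal), by positivity, ?_⟩
  intro v M hvc hvq hvM R hR1 x₀
  have hR : 0 < R := one_pos.trans_le hR1
  have hM0 : 0 ≤ M := ENNReal.toReal_nonneg.trans hvM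
  set Φ := probeBump R ⋆ φ.normed volume with hΦ
  have hΦ2 : ContDiff ℝ 2 Φ := contDiff_probeConv φ hR
  set L : (EuclideanSpace ℝ (Fin 3)) → ℝ := Δ (fun y => Φ (x₀ - y)) with hL
  have hL' : ∀ y, L y = (Δ Φ) (x₀ - y) := fun y => laplacian_comp_const_sub Φ x₀ y
  have hLc : Continuous L := by
    have : L = fun y => (Δ Φ) (x₀ - y) := funext hL'
    rw [this]
    exact (FluidPDE.continuous_laplacian hΦ2).comp (continuous_const.sub continuous_id)
  have hκ : 0 ≤ ‖a‖ * ((m * R ^ 3)⁻¹ * R⁻¹ ^ 2 * C₂) := by positivity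
  have hF : ∀ y, ‖⟪v y, L y • a⟫‖ ≤ ‖a‖ * ((m * R ^ 3)⁻¹ * R⁻¹ ^ 2 * C₂) * ‖v y‖ := fun y => by
    rw [Real.norm_eq_abs, inner_smul_right, abs_mul, hL' y]
    calc |(Δ Φ) (x₀ - y)| * |⟪v y, a⟫| ≤ ((m * R ^ 3)⁻¹ * R⁻¹ ^ 2 * C₂) * (‖v y‖ * ‖a‖) :=
          mul_le_mul (abs_laplacian_probeConv_le φ hR hC₂ _) (abs_real_inner_le_norm _ _)
            (abs_nonneg _) (by positivity)
      _ = ‖a‖ * ((m * R ^ 3)⁻¹ * R⁻¹ ^ 2 * C₂) * ‖v y‖ := by ring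
  have hF0 : ∀ y, 2 * R + 1 < dist y x₀ → ⟪v y, L y • a⟫ = 0 := fun y hy => by
    rw [hL' y, laplacian_probeConv_eq_zero φ hR, zero_smul, inner_zero_right]
    rw [← norm_neg, neg_sub, ← dist_eq_norm]
    linarith
  have hFm : AEStronglyMeasurable (fun y => ⟪v y, L y • a⟫) volume :=
    (hvc.inner (hLc.smul continuous_const)).aestronglyMeasurable
  obtain ⟨-, hI⟩ := norm_integral_le_of_kernel_bound
    (hvc.norm.continuousOn.integrableOn_compact (isCompact_closedBall x₀ (2 * R + 1))) hFm hF hF0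
  rw [← Real.norm_eq_abs]
  refine hI.trans ?_
  have hB := setIntegral_norm_probeBall_le hq1 hq hvq hR1 x₀
  calc ‖a‖ * ((m * R ^ 3)⁻¹ * R⁻¹ ^ 2 * C₂) * ∫ y in closedBall x₀ (2 * R + 1), ‖v y‖
      ≤ ‖a‖ * ((m * R ^ 3)⁻¹ * R⁻¹ ^ 2 * C₂) *
          ((27 * V₁) ^ (1 - 1 / q.toReal) * R ^ (3 - 3 / q.toReal) * M) := by
        refine mul_le_mul_of_nonneg_left (hB.trans ?_) hκ
        exact mul_le_mul_of_nonneg_left hvM (by positivity)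
    _ = ‖a‖ * m⁻¹ * C₂ * (27 * V₁) ^ (1 - 1 / q.toReal) * M *
          ((R ^ 3)⁻¹ * R⁻¹ ^ (2 : ℕ) * R ^ (3 - 3 / q.toReal)) := by
        rw [mul_inv]; ring
    _ = ‖a‖ * m⁻¹ * C₂ * (27 * V₁) ^ (1 - 1 / q.toReal) * M * R ^ (-((2 : ℕ) + 3 / q.toReal)) := by
        rw [rpow_kernel_algebra hR]

/-- **The transport term** `B = ∫ ⟪v, (v·∇)(Φ(x₀ − ·)) a⟫`: for `v` continuous with
`‖v‖_{L^{2P}} ≤ M`, `1 ≤ P < ∞`, `|B| ≤ K M² R^{−(1 + 3/P)}` (`‖DΦ‖ ≤ C₁(mR³)⁻¹R⁻¹` against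
`∫_B ‖v‖² ≤ |B|^{1−1/P} ‖v‖²_{2P}`). [folklore] -/
theorem exists_bound_transport {P : ℝ≥0∞} (hP1 : 1 ≤ P) (hP : P ≠ ⊤) (hφ : φ.rOut ≤ 1)
    (a : (EuclideanSpace ℝ (Fin 3))) : ∃ K, 0 ≤ K ∧
    ∀ (v : (EuclideanSpace ℝ (Fin 3)) → (EuclideanSpace ℝ (Fin 3))) (M : ℝ), Continuous v →
      MemLp v (P * 2) volume → (eLpNorm v (P * 2) volume).toReal ≤ M → ∀ R : ℝ, 1 ≤ R →
      ∀ x₀ : (EuclideanSpace ℝ (Fin 3)),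
      |∫ y, ⟪v y, fderiv ℝ (fun y => (probeBump R ⋆ φ.normed volume) (x₀ - y)) y (v y) • a⟫| ≤
        K * M ^ 2 * R ^ (-((1 : ℕ) + 3 / P.toReal)) := by
  obtain ⟨⟨C₁, hC₁⟩, ⟨C₂, hC₂⟩⟩ := exists_bound_baseBump_derivs (E := (EuclideanSpace ℝ (Fin 3)))
  have hC₁0 : 0 ≤ C₁ := (norm_nonneg _).trans (hC₁ 0)
  set m := baseBumpMass (EuclideanSpace ℝ (Fin 3)) with hm_def
  have hm : 0 < m := baseBumpMass_pos
  set V₁ := (volume : Measure (EuclideanSpace ℝ (Fin 3))).real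
    (closedBall (0 : (EuclideanSpace ℝ (Fin 3))) 1) with hV₁
  have hV₁0 : 0 ≤ V₁ := measureReal_nonneg
  refine ⟨‖a‖ * m⁻¹ * C₁ * (27 * V₁) ^ (1 - 1 / P.toReal), by positivity, ?_⟩
  intro v M hvc hvq hvM R hR1 x₀
  have hR : 0 < R := one_pos.trans_le hR1
  have hM0 : 0 ≤ M := ENNReal.toReal_nonneg.trans hvM
  set Φ := probeBump R ⋆ φ.normed volume with hΦ
  have hΦ1 : ContDiff ℝ 1 Φ := contDiff_probeConv φ hR
  have hD : ∀ y, fderiv ℝ (fun y => Φ (x₀ - y)) y = -fderiv ℝ Φ (x₀ - y) := fun y =>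
    fderiv_comp_const_sub Φ x₀ y
  have hκ : 0 ≤ ‖a‖ * ((m * R ^ 3)⁻¹ * R⁻¹ * C₁) := by positivity
  have hF : ∀ y, ‖⟪v y, fderiv ℝ (fun y => Φ (x₀ - y)) y (v y) • a⟫‖ ≤
      ‖a‖ * ((m * R ^ 3)⁻¹ * R⁻¹ * C₁) * ‖(‖v y‖ ^ 2)‖ := fun y => by
    rw [Real.norm_eq_abs, inner_smul_right, abs_mul, hD y, Real.norm_eq_abs,
      abs_of_nonneg (sq_nonneg ‖v y‖)]
    calc |(-fderiv ℝ Φ (x₀ - y)) (v y)| * |⟪v y, a⟫|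
        ≤ (‖fderiv ℝ Φ (x₀ - y)‖ * ‖v y‖) * (‖v y‖ * ‖a‖) := by
          refine mul_le_mul ?_ (abs_real_inner_le_norm _ _) (abs_nonneg _) (by positivity)
          rw [_root_.neg_apply, abs_neg, ← Real.norm_eq_abs]
          exact ContinuousLinearMap.le_opNorm _ _
      _ ≤ (((m * R ^ 3)⁻¹ * R⁻¹ * C₁) * ‖v y‖) * (‖v y‖ * ‖a‖) := by
          gcongr
          exact norm_fderiv_probeConv_le φ hR hC₁ _
      _ = ‖a‖ * ((m * R ^ 3)⁻¹ * R⁻¹ * C₁) * ‖v y‖ ^ 2 := by ring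
  have hF0 : ∀ y, 2 * R + 1 < dist y x₀ →
      ⟪v y, fderiv ℝ (fun y => Φ (x₀ - y)) y (v y) • a⟫ = 0 := by
    intro y hy
    have hy' : 2 * R + φ.rOut < ‖x₀ - y‖ := by
      rw [← norm_neg, neg_sub, ← dist_eq_norm]; linarith
    have hz : fderiv ℝ Φ (x₀ - y) = 0 := by
      ext w
      rw [fderiv_probeConv_apply_eq_zero φ hR hy']
      rfl
    rw [hD y, hz, neg_zero, _root_.zero_apply, zero_smul, inner_zero_right]
  have hFm : AEStronglyMeasurable
      (fun y => ⟪v y, fderiv ℝ (fun y => Φ (x₀ - y)) y (v y) • a⟫) volume := by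
    have hc : Continuous fun y => fderiv ℝ (fun y => Φ (x₀ - y)) y (v y) := by
      have e : (fun y => fderiv ℝ (fun y => Φ (x₀ - y)) y (v y)) =
          fun y => (-fderiv ℝ Φ (x₀ - y)) (v y) := funext fun y => by rw [hD y]
      rw [e]
      exact ((hΦ1.continuous_fderiv one_ne_zero).comp
        (continuous_const.sub continuous_id)).neg.clm_apply hvc
    exact (hvc.inner (hc.smul continuous_const)).aestronglyMeasurable
  have hsq_cont : Continuous fun y => ‖v y‖ ^ 2 := hvc.norm.pow 2
  obtain ⟨-, hI⟩ := norm_integral_le_of_kernel_bound (H := fun y => ‖(‖v y‖ ^ 2)‖)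
    (hsq_cont.norm.continuousOn.integrableOn_compact (isCompact_closedBall x₀ (2 * R + 1)))
    hFm hF hF0
  rw [← Real.norm_eq_abs]
  refine hI.trans ?_
  -- `‖v‖² ∈ L^P` with `‖ ‖v‖² ‖_P = ‖v‖²_{2P}`
  have hsq : MemLp (fun y => ‖v y‖ ^ 2) P volume := by
    have h := hvq.norm_rpow_div (2 : ℝ≥0∞)
    have he : P * 2 / 2 = P := ENNReal.mul_div_cancel_right two_ne_zero ENNReal.ofNat_ne_top
    rw [he, ENNReal.toReal_ofNat] at h
    refine (memLp_congr_ae (Eventually.of_forall fun y => ?_)).1 h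
    show ‖v y‖ ^ (2 : ℝ) = ‖v y‖ ^ 2
    exact Real.rpow_two _
  have hnorm : (eLpNorm (fun y => ‖v y‖ ^ 2) P volume).toReal ≤ M ^ 2 := by
    rw [eLpNorm_norm_sq_eq_mul_two, ENNReal.toReal_pow]
    exact pow_le_pow_left₀ ENNReal.toReal_nonneg hvM 2
  have hB := setIntegral_norm_probeBall_le hP1 hP hsq hR1 x₀
  calc ‖a‖ * ((m * R ^ 3)⁻¹ * R⁻¹ * C₁) * ∫ y in closedBall x₀ (2 * R + 1), ‖(‖v y‖ ^ 2)‖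
      ≤ ‖a‖ * ((m * R ^ 3)⁻¹ * R⁻¹ * C₁) *
          ((27 * V₁) ^ (1 - 1 / P.toReal) * R ^ (3 - 3 / P.toReal) * M ^ 2) := by
        refine mul_le_mul_of_nonneg_left (hB.trans ?_) hκ
        exact mul_le_mul_of_nonneg_left hnorm (by positivity)
    _ = ‖a‖ * m⁻¹ * C₁ * (27 * V₁) ^ (1 - 1 / P.toReal) * M ^ 2 *
          ((R ^ 3)⁻¹ * R⁻¹ ^ (1 : ℕ) * R ^ (3 - 3 / P.toReal)) := by
        rw [mul_inv, pow_one]; ring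
    _ = ‖a‖ * m⁻¹ * C₁ * (27 * V₁) ^ (1 - 1 / P.toReal) * M ^ 2 *
          R ^ (-((1 : ℕ) + 3 / P.toReal)) := by
        rw [rpow_kernel_algebra hR]

/-- **The potential term** `D = ∫ ∂ₐΦ(y) Q(x₀ − y) dy`: for `Q ∈ L^P`, `1 ≤ P < ∞`, with
`‖Q‖_P ≤ N`, `|D| ≤ K N R^{−(1 + 3/P)}` (`|∂ₐΦ| ≤ C₁(mR³)⁻¹R⁻¹‖a‖`, Hölder). [folklore] -/
theorem exists_bound_potential {P : ℝ≥0∞} (hP1 : 1 ≤ P) (hP : P ≠ ⊤) (hφ : φ.rOut ≤ 1)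
    (a : (EuclideanSpace ℝ (Fin 3))) : ∃ K, 0 ≤ K ∧
    ∀ (Q : (EuclideanSpace ℝ (Fin 3)) → ℝ) (N : ℝ), MemLp Q P volume →
    (eLpNorm Q P volume).toReal ≤ N → ∀ R : ℝ, 1 ≤ R → ∀ x₀ : (EuclideanSpace ℝ (Fin 3)),
      |∫ y, fderiv ℝ (probeBump R ⋆ φ.normed volume) y a * Q (x₀ - y)| ≤
        K * N * R ^ (-((1 : ℕ) + 3 / P.toReal)) := by
  obtain ⟨⟨C₁, hC₁⟩, ⟨C₂, hC₂⟩⟩ := exists_bound_baseBump_derivs (E := (EuclideanSpace ℝ (Fin 3)))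
  have hC₁0 : 0 ≤ C₁ := (norm_nonneg _).trans (hC₁ 0)
  set m := baseBumpMass (EuclideanSpace ℝ (Fin 3)) with hm_def
  have hm : 0 < m := baseBumpMass_pos
  set V₁ := (volume : Measure (EuclideanSpace ℝ (Fin 3))).real
    (closedBall (0 : (EuclideanSpace ℝ (Fin 3))) 1) with hV₁
  have hV₁0 : 0 ≤ V₁ := measureReal_nonneg
  refine ⟨‖a‖ * m⁻¹ * C₁ * (27 * V₁) ^ (1 - 1 / P.toReal), by positivity, ?_⟩
  intro Q N hQ hQN R hR1 x₀
  have hR : 0 < R := one_pos.trans_le hR1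
  have hN0 : 0 ≤ N := ENNReal.toReal_nonneg.trans hQN
  set Φ := probeBump R ⋆ φ.normed volume with hΦ
  have hΦ1 : ContDiff ℝ 1 Φ := contDiff_probeConv φ hR
  have hΦa : Continuous fun y => fderiv ℝ Φ y a :=
    (hΦ1.continuous_fderiv one_ne_zero).clm_apply continuous_const
  -- move the translation onto the kernel
  rw [← integral_sub_left_eq_self (fun y => fderiv ℝ Φ y a * Q (x₀ - y)) volume x₀]
  simp only [sub_sub_cancel]
  have hκ : 0 ≤ (m * R ^ 3)⁻¹ * R⁻¹ * C₁ * ‖a‖ := by positivity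
  have hF : ∀ y, ‖fderiv ℝ Φ (x₀ - y) a * Q y‖ ≤ (m * R ^ 3)⁻¹ * R⁻¹ * C₁ * ‖a‖ * ‖Q y‖ :=
    fun y => by
    rw [Real.norm_eq_abs, abs_mul, Real.norm_eq_abs]
    exact mul_le_mul_of_nonneg_right (abs_fderiv_probeConv_apply_le φ hR hC₁ _ a) (abs_nonneg _)
  have hF0 : ∀ y, 2 * R + 1 < dist y x₀ → fderiv ℝ Φ (x₀ - y) a * Q y = 0 := fun y hy => by
    have hy' : 2 * R + φ.rOut < ‖x₀ - y‖ := by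
      rw [← norm_neg, neg_sub, ← dist_eq_norm]; linarith
    rw [fderiv_probeConv_apply_eq_zero φ hR hy', zero_mul]
  have hFm : AEStronglyMeasurable (fun y => fderiv ℝ Φ (x₀ - y) a * Q y) volume :=
    ((hΦa.comp (continuous_const.sub continuous_id)).aestronglyMeasurable).mul hQ.1
  obtain ⟨-, hI⟩ := norm_integral_le_of_kernel_bound
    (((hQ.locallyIntegrable hP1).integrableOn_isCompact
      (isCompact_closedBall x₀ (2 * R + 1))).norm) hFm hF hF0
  rw [← Real.norm_eq_abs]
  refine hI.trans ?_
  have hB := setIntegral_norm_probeBall_le hP1 hP hQ hR1 x₀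
  calc (m * R ^ 3)⁻¹ * R⁻¹ * C₁ * ‖a‖ * ∫ y in closedBall x₀ (2 * R + 1), ‖Q y‖
      ≤ (m * R ^ 3)⁻¹ * R⁻¹ * C₁ * ‖a‖ *
          ((27 * V₁) ^ (1 - 1 / P.toReal) * R ^ (3 - 3 / P.toReal) * N) := by
        refine mul_le_mul_of_nonneg_left (hB.trans ?_) hκ
        exact mul_le_mul_of_nonneg_left hQN (by positivity)
    _ = ‖a‖ * m⁻¹ * C₁ * (27 * V₁) ^ (1 - 1 / P.toReal) * N *
          ((R ^ 3)⁻¹ * R⁻¹ ^ (1 : ℕ) * R ^ (3 - 3 / P.toReal)) := by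
        rw [mul_inv, pow_one]; ring
    _ = ‖a‖ * m⁻¹ * C₁ * (27 * V₁) ^ (1 - 1 / P.toReal) * N *
          R ^ (-((1 : ℕ) + 3 / P.toReal)) := by
        rw [rpow_kernel_algebra hR]

end Bounds


/-! ### Assembly: `∇(θ ⋆ g(t)) = 0` and the a.e. identity -/

/-- Exponent comparison: for `R ≥ 1`, `0 ≤ k` and `e ≤ s + k`, `R^{−(k+s)} ≤ R^{−e}`. [folklore] -/
theorem rpow_neg_le_rpow_neg {R k s e : ℝ} (hR : 1 ≤ R) (he : e ≤ s + k) :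
    R ^ (-(k + s)) ≤ R ^ (-e) :=
  Real.rpow_le_rpow_of_exponent_le hR (by linarith)

/-- Choice of the scale: for `K ≥ 0`, `ε > 0`, `e > 0` there is `R ≥ 1` with `K R^{−e} ≤ ε`. [folklore] -/
theorem exists_scale {K ε e : ℝ} (hK : 0 ≤ K) (hε : 0 < ε) (he : 0 < e) :
    ∃ R : ℝ, 1 ≤ R ∧ K * R ^ (-e) ≤ ε := by
  refine ⟨max 1 ((K / ε) ^ e⁻¹), le_max_left _ _, ?_⟩
  set R := max 1 ((K / ε) ^ e⁻¹) with hR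
  have hR0 : 0 < R := one_pos.trans_le (le_max_left _ _)
  have h1 : K / ε ≤ R ^ e := by
    calc K / ε = ((K / ε) ^ e⁻¹) ^ e := (Real.rpow_inv_rpow (by positivity) he.ne').symm
      _ ≤ R ^ e := Real.rpow_le_rpow (by positivity) (le_max_right _ _) he.le
  rw [Real.rpow_neg hR0.le, ← div_eq_mul_inv, div_le_iff₀ (Real.rpow_pos_of_pos hR0 e)]
  rwa [div_le_iff₀ hε, mul_comm] at h1

/-- **`∇(θ ⋆ (p(t) − Q(t))) = 0`** (Tao 2011, §4, conclusion of the proof of Lemma 4.1 (i),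
for `L^{2P}` slices, `1 ≤ P < ∞`). For a classical solution of the unforced system on `(t₁, t₂)`
with `ν ≥ 0`, `‖u(t)‖_{L^{2P}} ≤ M`, and weak-Poisson pressure candidates `Q(t) ∈ L^P`,
`‖Q(t)‖_{L^P} ≤ N`, on `(t₁, t₂)`, and every normed bump `θ` of outer radius `≤ 1`: the mollified
harmonic part has vanishing derivative at every point, for every `t ∈ (t₁, t₂)` — by the probe
identity `∂ₐ(θ ⋆ g)(t, x₀) = −W_R'(t) + O(R^{−3/(2P)})` with `|W_R| = O(R^{−3/(2P)})` uniformly in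
`t`, and the real-variable uniqueness lemma of `HarmonicProbe`. [cite: Tao2011, §4, proof of Lemma 4.1 (i)] -/
theorem fderiv_mollified_harmonicPart_eq_zero {t₁ t₂ : ℝ} (hν : 0 ≤ ν)
    (h : IsClassicalNSSolutionOn (Ioo t₁ t₂) ν 0 u p) {P : ℝ≥0∞} (hP1 : 1 ≤ P) (hP : P ≠ ⊤)
    (hu : ∀ t ∈ Ioo t₁ t₂, MemLp (u t) (P * 2) volume) {M : ℝ}
    (hM : ∀ t ∈ Ioo t₁ t₂, (eLpNorm (u t) (P * 2) volume).toReal ≤ M)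
    {Q : ℝ → (EuclideanSpace ℝ (Fin 3)) → ℝ} (hQ : ∀ t ∈ Ioo t₁ t₂, MemLp (Q t) P volume) {N : ℝ}
    (hN : ∀ t ∈ Ioo t₁ t₂, (eLpNorm (Q t) P volume).toReal ≤ N)
    (hQP : ∀ t ∈ Ioo t₁ t₂, ∀ ψ : (EuclideanSpace ℝ (Fin 3)) → ℝ, ContDiff ℝ ∞ ψ →
      HasCompactSupport ψ →
      ∫ y, Q t y * (Δ ψ) y = -∫ y, fderiv ℝ (fderiv ℝ ψ) y (u t y) (u t y))
    (φ : ContDiffBump (0 : (EuclideanSpace ℝ (Fin 3)))) (hφ : φ.rOut ≤ 1)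
    (x₀ a : (EuclideanSpace ℝ (Fin 3))) :
    ∀ t ∈ Ioo t₁ t₂, fderiv ℝ (φ.normed volume ⋆ fun x => p t x - Q t x) x₀ a = 0 := by
  have hS : IsOpen (Ioo t₁ t₂) := isOpen_Ioo
  -- exponents
  have hP21 : 1 ≤ P * 2 := hP1.trans (le_mul_of_one_le_right zero_le one_le_two)
  have hP2 : P * 2 ≠ ⊤ := ENNReal.mul_ne_top hP ENNReal.ofNat_ne_top
  have hPpos : 0 < P.toReal := ENNReal.toReal_pos (zero_lt_one.trans_le hP1).ne' hP
  have hP2r : (P * 2).toReal = P.toReal * 2 := by rw [ENNReal.toReal_mul, ENNReal.toReal_ofNat]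
  set e₀ : ℝ := 3 / (P * 2).toReal with he₀
  have he₀pos : 0 < e₀ := by rw [he₀, hP2r]; positivity
  have he₀P : e₀ ≤ 3 / P.toReal := by
    rw [he₀, hP2r]
    rw [div_le_div_iff_of_pos_left (by norm_num) (by positivity) hPpos]
    linarith
  -- the constants of the four bounds
  obtain ⟨K₁, hK₁0, hK₁⟩ := exists_bound_laplacian φ hP21 hP2 hφ a
  obtain ⟨K₂, hK₂0, hK₂⟩ := exists_bound_transport φ hP1 hP hφ a
  obtain ⟨K₃, hK₃0, hK₃⟩ := exists_bound_boundary φ hP21 hP2 hφ a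
  obtain ⟨K₄, hK₄0, hK₄⟩ := exists_bound_potential φ hP1 hP hφ a
  -- non-emptiness bookkeeping: if the interval is empty there is nothing to prove
  by_cases hne : (Ioo t₁ t₂).Nonempty
  swap
  · intro t ht; exact absurd ⟨t, ht⟩ hne
  obtain ⟨t₀, ht₀⟩ := hne
  have hM0 : 0 ≤ M := ENNReal.toReal_nonneg.trans (hM t₀ ht₀)
  have hN0 : 0 ≤ N := ENNReal.toReal_nonneg.trans (hN t₀ ht₀)
  obtain ⟨K, hK⟩ : ∃ K : ℝ, K = (ν * K₁ + K₃) * M + K₂ * M ^ 2 + K₄ * N := ⟨_, rfl⟩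
  have hνK : 0 ≤ ν * K₁ := mul_nonneg hν hK₁0
  have hKnn : 0 ≤ K := by rw [hK]; positivity
  have hK3le : K₃ * M ≤ K := by
    have h1 := mul_nonneg hνK hM0
    have h2 := mul_nonneg hK₂0 (sq_nonneg M)
    have h3 := mul_nonneg hK₄0 hN0
    rw [hK]; linarith
  have hK124le : (ν * K₁) * M + K₂ * M ^ 2 + K₄ * N ≤ K := by
    have h1 := mul_nonneg hK₃0 hM0
    rw [hK]; linarith
  -- data along the flow
  have hdata : ∀ t ∈ Ioo t₁ t₂, Continuous (u t) := fun t ht => (h.contDiff_velocity ht).continuous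
  refine eq_zero_of_approx_antiderivative fun ε hε => ?_
  -- the scale `R ≥ 1` with `K R^{-e₀} ≤ ε`
  obtain ⟨R, hR1, hKR⟩ := exists_scale hKnn hε he₀pos
  have hR0 : 0 < R := one_pos.trans_le hR1
  have hRe : 0 ≤ R ^ (-e₀) := Real.rpow_nonneg hR0.le _
  -- the four rates are dominated by `R^{-e₀}`
  have r0 : R ^ (-(((0 : ℕ) : ℝ) + 3 / (P * 2).toReal)) = R ^ (-e₀) := by
    rw [Nat.cast_zero, zero_add]
  have r2 : R ^ (-(((2 : ℕ) : ℝ) + 3 / (P * 2).toReal)) ≤ R ^ (-e₀) :=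
    rpow_neg_le_rpow_neg hR1 (by rw [he₀]; norm_num)
  have r1 : R ^ (-(((1 : ℕ) : ℝ) + 3 / P.toReal)) ≤ R ^ (-e₀) :=
    rpow_neg_le_rpow_neg hR1 (by norm_num; linarith)
  -- the test field `Ψ(y) = Φ(x₀ - y) a` and the boundary term
  set Φ := probeBump R ⋆ φ.normed volume with hΦdef
  have hΦs : ContDiff ℝ ∞ Φ := contDiff_probeConv φ hR0
  have hΦc : HasCompactSupport Φ := hasCompactSupport_probeConv φ hR0
  have hΨs : ContDiff ℝ ∞ fun y : (EuclideanSpace ℝ (Fin 3)) => Φ (x₀ - y) • a :=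
    (hΦs.comp (contDiff_const.sub contDiff_id)).smul contDiff_const
  have hΨc : HasCompactSupport fun y : (EuclideanSpace ℝ (Fin 3)) => Φ (x₀ - y) • a :=
    (hΦc.comp_homeomorph (Homeomorph.subLeft x₀)).smul_right (f' := fun _ => a)
  refine ⟨fun s => ∫ y, ⟪u s y, Φ (x₀ - y) • a⟫,
    fun s => ∫ y, ⟪FluidPDE.timeDerivWithin (Ioo t₁ t₂) u s y, Φ (x₀ - y) • a⟫,
    PressureNormalisationL3.continuousOn_integral_inner_timeDerivWithin h hS hΨs.continuous hΨc,
    fun t ht => PressureNormalisationL3.hasDerivAt_integral_inner_velocity h hS hΨs hΨc ht,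
    fun t ht => ?_, fun t ht => ?_⟩
  · -- `|W| ≤ ε`
    have hb := (hK₃ (u t) M (hdata t ht) (hu t ht) (hM t ht) R hR1 x₀).2
    rw [r0] at hb
    calc |∫ y, ⟪u t y, Φ (x₀ - y) • a⟫| ≤ K₃ * M * R ^ (-e₀) := hb
      _ ≤ K * R ^ (-e₀) := mul_le_mul_of_nonneg_right hK3le hRe
      _ ≤ ε := hKR
  · -- `|g + W'| ≤ ε`
    have b1 := hK₁ (u t) M (hdata t ht) (hu t ht) (hM t ht) R hR1 x₀
    have b2 := hK₂ (u t) M (hdata t ht) (hu t ht) (hM t ht) R hR1 x₀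
    have b4 := hK₄ (Q t) N (hQ t ht) (hN t ht) R hR1 x₀
    have key := fderiv_mollified_harmonicPart_eq h hS ht ((hQ t ht).locallyIntegrable hP1)
      (hQP t ht) φ hR0 x₀ a
    rw [key]
    dsimp only
    generalize (∫ y, ⟪u t y, (Δ (fun y => Φ (x₀ - y))) y • a⟫) = A at b1 ⊢
    generalize (∫ y, ⟪u t y, fderiv ℝ (fun y => Φ (x₀ - y)) y (u t y) • a⟫) = B at b2 ⊢
    generalize (∫ y, fderiv ℝ Φ y a * Q t (x₀ - y)) = D at b4 ⊢
    generalize (∫ y, ⟪FluidPDE.timeDerivWithin (Ioo t₁ t₂) u t y, Φ (x₀ - y) • a⟫) = C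
    have e : ν * A + B - C - D + C = ν * A + B - D := by ring
    rw [e]
    have b1' : |A| ≤ K₁ * M * R ^ (-e₀) :=
      b1.trans (mul_le_mul_of_nonneg_left r2 (mul_nonneg hK₁0 hM0))
    have b2' : |B| ≤ K₂ * M ^ 2 * R ^ (-e₀) :=
      b2.trans (mul_le_mul_of_nonneg_left r1 (mul_nonneg hK₂0 (sq_nonneg M)))
    have b4' : |D| ≤ K₄ * N * R ^ (-e₀) :=
      b4.trans (mul_le_mul_of_nonneg_left r1 (mul_nonneg hK₄0 hN0))
    calc |ν * A + B - D| ≤ ν * |A| + |B| + |D| := by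
          calc |ν * A + B - D| ≤ |ν * A + B| + |D| := abs_sub _ _
            _ ≤ |ν * A| + |B| + |D| := by gcongr; exact abs_add_le _ _
            _ = ν * |A| + |B| + |D| := by rw [abs_mul, abs_of_nonneg hν]
      _ ≤ ν * (K₁ * M * R ^ (-e₀)) + K₂ * M ^ 2 * R ^ (-e₀) + K₄ * N * R ^ (-e₀) := by
          gcongr
      _ = ((ν * K₁) * M + K₂ * M ^ 2 + K₄ * N) * R ^ (-e₀) := by ring
      _ ≤ K * R ^ (-e₀) := mul_le_mul_of_nonneg_right hK124le hRe
      _ ≤ ε := hKR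

/-- **Every mollification of the harmonic part is constant** (`θ` a normed bump of outer radius
`≤ 1`, `t ∈ (t₁, t₂)`; hypotheses as in `fderiv_mollified_harmonicPart_eq_zero`). [cite: Tao2011, §4, proof of Lemma 4.1 (i)] -/
theorem mollified_harmonicPart_eq_const {t₁ t₂ : ℝ} (hν : 0 ≤ ν)
    (h : IsClassicalNSSolutionOn (Ioo t₁ t₂) ν 0 u p) {P : ℝ≥0∞} (hP1 : 1 ≤ P) (hP : P ≠ ⊤)
    (hu : ∀ t ∈ Ioo t₁ t₂, MemLp (u t) (P * 2) volume) {M : ℝ}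
    (hM : ∀ t ∈ Ioo t₁ t₂, (eLpNorm (u t) (P * 2) volume).toReal ≤ M)
    {Q : ℝ → (EuclideanSpace ℝ (Fin 3)) → ℝ} (hQ : ∀ t ∈ Ioo t₁ t₂, MemLp (Q t) P volume) {N : ℝ}
    (hN : ∀ t ∈ Ioo t₁ t₂, (eLpNorm (Q t) P volume).toReal ≤ N)
    (hQP : ∀ t ∈ Ioo t₁ t₂, ∀ ψ : (EuclideanSpace ℝ (Fin 3)) → ℝ, ContDiff ℝ ∞ ψ →
      HasCompactSupport ψ →
      ∫ y, Q t y * (Δ ψ) y = -∫ y, fderiv ℝ (fderiv ℝ ψ) y (u t y) (u t y))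
    (φ : ContDiffBump (0 : (EuclideanSpace ℝ (Fin 3)))) (hφ : φ.rOut ≤ 1) {t : ℝ}
    (ht : t ∈ Ioo t₁ t₂) (x : (EuclideanSpace ℝ (Fin 3))) :
    (φ.normed volume ⋆ fun x => p t x - Q t x) x =
      (φ.normed volume ⋆ fun x => p t x - Q t x) 0 := by
  have hcd : ContDiff ℝ 1 (φ.normed volume ⋆ fun x => p t x - Q t x) :=
    (φ.hasCompactSupport_normed).contDiff_convolution_left _ φ.contDiff_normed
      (locallyIntegrable_harmonicPart h ht ((hQ t ht).locallyIntegrable hP1))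
  have hdiff : Differentiable ℝ (φ.normed volume ⋆ fun x => p t x - Q t x) :=
    hcd.differentiable one_ne_zero
  refine is_const_of_fderiv_eq_zero hdiff (fun y => ?_) x 0
  ext a
  rw [fderiv_mollified_harmonicPart_eq_zero hν h hP1 hP hu hM hQ hN hQP φ hφ y a t ht]
  rfl

/-- **Tao 2011, Lemma 4.1 (i), for `L^{2P}` slices (pressure normalisation).** Let `(u, p)` be a
classical solution of the unforced Navier–Stokes system with viscosity `ν ≥ 0` on an open time
interval `(t₁, t₂)` (`IsClassicalNSSolutionOn (Ioo t₁ t₂) ν 0 u p`), with slices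
`u(t) ∈ L^{2P}(ℝ³)`, `1 ≤ P < ∞`, `‖u(t)‖_{L^{2P}} ≤ M`, and let `Q(t) ∈ L^P`, `‖Q(t)‖_{L^P} ≤ N`,
solve the weak Poisson equation `∫ Q(t) Δψ = −∫ D²ψ(u(t), u(t))` for all test functions `ψ`, for
`t ∈ (t₁, t₂)`. Then for every `t ∈ (t₁, t₂)` there is a constant `C` with `p(t, x) = Q(t)(x) + C`
for a.e. `x` (Tao: "`p = −Δ⁻¹∂ᵢ∂ⱼ(uᵢuⱼ) + C(t)`", the argument run in `L^{2P} × L^P`).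
[cite: Tao2011, Lemma 4.1 (i) and its proof, §4] -/
theorem pressure_ae_eq_add_const {t₁ t₂ : ℝ} (hν : 0 ≤ ν)
    (h : IsClassicalNSSolutionOn (Ioo t₁ t₂) ν 0 u p) {P : ℝ≥0∞} (hP1 : 1 ≤ P) (hP : P ≠ ⊤)
    (hu : ∀ t ∈ Ioo t₁ t₂, MemLp (u t) (P * 2) volume) {M : ℝ}
    (hM : ∀ t ∈ Ioo t₁ t₂, (eLpNorm (u t) (P * 2) volume).toReal ≤ M)
    {Q : ℝ → (EuclideanSpace ℝ (Fin 3)) → ℝ} (hQ : ∀ t ∈ Ioo t₁ t₂, MemLp (Q t) P volume) {N : ℝ}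
    (hN : ∀ t ∈ Ioo t₁ t₂, (eLpNorm (Q t) P volume).toReal ≤ N)
    (hQP : ∀ t ∈ Ioo t₁ t₂, ∀ ψ : (EuclideanSpace ℝ (Fin 3)) → ℝ, ContDiff ℝ ∞ ψ →
      HasCompactSupport ψ →
      ∫ y, Q t y * (Δ ψ) y = -∫ y, fderiv ℝ (fderiv ℝ ψ) y (u t y) (u t y))
    {t : ℝ} (ht : t ∈ Ioo t₁ t₂) :
    ∃ C : ℝ, ∀ᵐ x ∂(volume : Measure (EuclideanSpace ℝ (Fin 3))), p t x = Q t x + C := by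
  obtain ⟨C, hC⟩ := ConvolutionLaplacian.ae_eq_const_of_forall_convolution_normed_const
    (locallyIntegrable_harmonicPart h ht ((hQ t ht).locallyIntegrable hP1))
    (fun φ hφ => ⟨_, fun x => mollified_harmonicPart_eq_const hν h hP1 hP hu hM hQ hN hQP φ hφ ht x⟩)
  refine ⟨C, hC.mono fun x hx => ?_⟩
  have hx' : p t x - Q t x = C := hx
  linarith

/-- **The pressure of a classical solution with `L^{2q}` slices is a Riesz pressure, up to a
constant** (`1 < q < ∞`): combining `pressure_ae_eq_add_const` with the Calderón–Zygmund pressure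
of `exists_rieszPressure` (Nečas–Růžička–Šverák 1996, §2), for a classical solution of the unforced
system on `(t₁, t₂)` with `ν ≥ 0` and `‖u(t)‖_{L^{2q}} ≤ M` there is, for every `t ∈ (t₁, t₂)`, a
constant `C(t)` such that `p(t) − C(t) ∈ L^q` with `‖p(t) − C(t)‖_{L^q} ≤ C_q ‖u(t)‖²_{L^{2q}}` and
`∫ (p(t) − C(t)) Δψ = −∫ D²ψ(u(t), u(t))` for all test functions `ψ` — "`p := (-Δ)⁻¹ div div u ⊗ u`
is the pressure associated to `u`" (Albritton 2018, proof of Prop. 4.5). The constant `C_q` is that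
of `exists_rieszPressure`, independent of the solution. [cite: Tao2011, Lemma 4.1 (i)] -/
theorem exists_pressure_sub_const_memLp {q : ℝ} (hq : 1 < q) :
    ∃ Cq : ℝ≥0, ∀ t₁ t₂ : ℝ, 0 ≤ ν → IsClassicalNSSolutionOn (Ioo t₁ t₂) ν 0 u p →
      ∀ M : ℝ≥0, (∀ t ∈ Ioo t₁ t₂, MemLp (u t) (ENNReal.ofReal q * 2) volume) →
      (∀ t ∈ Ioo t₁ t₂, eLpNorm (u t) (ENNReal.ofReal q * 2) volume ≤ M) →
      ∀ t ∈ Ioo t₁ t₂, ∃ C : ℝ,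
        MemLp (fun x => p t x - C) (ENNReal.ofReal q) volume ∧
        eLpNorm (fun x => p t x - C) (ENNReal.ofReal q) volume ≤
          Cq * eLpNorm (u t) (ENNReal.ofReal q * 2) volume ^ 2 ∧
        ∀ ψ : (EuclideanSpace ℝ (Fin 3)) → ℝ, ContDiff ℝ ∞ ψ → HasCompactSupport ψ →
          ∫ y, (p t y - C) * (Δ ψ) y = -∫ y, fderiv ℝ (fderiv ℝ ψ) y (u t y) (u t y) := by
  obtain ⟨Cq, hCq⟩ := exists_rieszPressure hq
  refine ⟨Cq, fun t₁ t₂ hν h M hu hM t ht => ?_⟩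
  have hq0 : 0 < q := by linarith
  set P : ℝ≥0∞ := ENNReal.ofReal q with hPdef
  have hP1 : 1 ≤ P := by
    rw [hPdef, ← ENNReal.ofReal_one]; exact ENNReal.ofReal_le_ofReal hq.le
  have hP : P ≠ ⊤ := ENNReal.ofReal_ne_top
  -- the Riesz pressures along the flow
  have hex : ∀ s ∈ Ioo t₁ t₂, ∃ Qs : (EuclideanSpace ℝ (Fin 3)) → ℝ, MemLp Qs P volume ∧
      eLpNorm Qs P volume ≤ Cq * eLpNorm (u s) (P * 2) volume ^ 2 ∧
      ∀ ψ : (EuclideanSpace ℝ (Fin 3)) → ℝ, ContDiff ℝ (⊤ : ℕ∞) ψ → HasCompactSupport ψ →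
        ∫ y, Qs y * (Δ ψ) y = -∫ y, fderiv ℝ (fderiv ℝ ψ) y (u s y) (u s y) :=
    fun s hs => hCq (u s) (hu s hs)
  classical
  set Q : ℝ → (EuclideanSpace ℝ (Fin 3)) → ℝ := fun s =>
    if hs : s ∈ Ioo t₁ t₂ then (hex s hs).choose else 0 with hQdef
  have hQspec : ∀ s (hs : s ∈ Ioo t₁ t₂), MemLp (Q s) P volume ∧
      eLpNorm (Q s) P volume ≤ Cq * eLpNorm (u s) (P * 2) volume ^ 2 ∧
      ∀ ψ : (EuclideanSpace ℝ (Fin 3)) → ℝ, ContDiff ℝ (⊤ : ℕ∞) ψ → HasCompactSupport ψ →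
        ∫ y, Q s y * (Δ ψ) y = -∫ y, fderiv ℝ (fderiv ℝ ψ) y (u s y) (u s y) := by
    intro s hs
    have e : Q s = (hex s hs).choose := by simp only [hQdef, dif_pos hs]
    rw [e]
    exact (hex s hs).choose_spec
  -- uniform bounds in real form
  have hMr : ∀ s ∈ Ioo t₁ t₂, (eLpNorm (u s) (P * 2) volume).toReal ≤ (M : ℝ) := fun s hs => by
    have := ENNReal.toReal_mono ENNReal.coe_ne_top (hM s hs)
    simpa using this
  have hNr : ∀ s ∈ Ioo t₁ t₂, (eLpNorm (Q s) P volume).toReal ≤ (Cq : ℝ) * (M : ℝ) ^ 2 := by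
    intro s hs
    have h1 : eLpNorm (Q s) P volume ≤ Cq * (M : ℝ≥0∞) ^ 2 :=
      (hQspec s hs).2.1.trans (by gcongr; exact hM s hs)
    have hne : (Cq : ℝ≥0∞) * (M : ℝ≥0∞) ^ 2 ≠ ⊤ :=
      ENNReal.mul_ne_top ENNReal.coe_ne_top (ENNReal.pow_ne_top ENNReal.coe_ne_top)
    have h2 := ENNReal.toReal_mono hne h1
    rw [ENNReal.toReal_mul, ENNReal.toReal_pow] at h2
    simpa using h2
  obtain ⟨C, hC⟩ := pressure_ae_eq_add_const hν h hP1 hP hu hMr (fun s hs => (hQspec s hs).1) hNr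
    (fun s hs ψ hψ hψc => (hQspec s hs).2.2 ψ hψ hψc) ht
  -- `p t - C = Q t` a.e.
  have hae : (fun x => p t x - C) =ᵐ[volume] Q t := by
    filter_upwards [hC] with x hx
    rw [hx]; ring
  refine ⟨C, (memLp_congr_ae hae).2 (hQspec t ht).1, ?_, fun ψ hψ hψc => ?_⟩
  · rw [eLpNorm_congr_ae hae]; exact (hQspec t ht).2.1
  · rw [← (hQspec t ht).2.2 ψ hψ hψc]
    exact integral_congr_ae (by filter_upwards [hae] with x hx; rw [hx])

end PressureNormalisationLp

end Literature.Analysis.FluidPDE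

end
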